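import Literature.NumberTheory.Sieve.DeshouillersIwaniecLargeSieveHol
import Literature.NumberTheory.Sieve.KloostermanQuadraticFormsShort
import Literature.NumberTheory.Sieve.BombieriFriedlanderIwaniecKuznetsovBoundFromSpectral
import HarnessLib

/-!
# The holomorphic large-sieve hypotheses `LSHolInf`, `LSHolZero` of the Kuznetsov package from Petersson's formula

The tree's reduction `BFI.L1.…Theorem1_of_kuznetsov` (file `…KuznetsovBoundFromSpectral`) of the
Bombieri–Friedlander–Iwaniec theorem takes, among its eleven hypotheses on abstract spectral data
`D : ℕ → BFI.L1.SpecData`, the two large sieve inequalities `LSHolInf D`, `LSHolZero D` for the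
Fourier coefficients `PH`, `QH` of holomorphic cusp forms at the cusps `∞` and `0` of `Γ₀(r)`
([DeshouillersIwaniec1982, Theorem 2 (1.28)]; [Drappeau2017, Prop. 4.7 (4.19)]).  Here both are
DERIVED from PETERSSON'S FORMULA at the respective cusp — the hypotheses `PetInf D`, `PetZero D`
(the predicate `DeshouillersIwaniec.PeterssonFamily` of `…LargeSieveHol` for the arrays `PH`, resp.
`QH`) — by the theorem `DeshouillersIwaniec.largeSieve_hol_of_petersson` (D–I's proof of §5.2) and
Proposition 3 (1.27) (`DeshouillersIwaniec.norm_quadB_le_short`).  Nothing else is assumed.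

## References
* [DeshouillersIwaniec1982] J.-M. Deshouillers, H. Iwaniec, *Kloosterman sums and Fourier coefficients
  of cusp forms*, Invent. Math. 70 (1982): Theorem 2 (1.28); (4.4); §5.2.
* [Drappeau2017] S. Drappeau, *Sums of Kloosterman sums in arithmetic progressions, and the error term
  in the dispersion method*, Proc. LMS 114 (2017): Prop. 4.7 (4.19), §4.1.2.
-/

noncomputable section

open Finset Real

namespace Literature.NumberTheory.Sieve

namespace BFI.L1

open DeshouillersIwaniec

/-- **Hypothesis (P∞): Petersson's formula at the cusp `∞`** for the holomorphic data `(ιh, wt, PH)`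
of `D r`, every level `r ≥ 1` (the predicate `DeshouillersIwaniec.PeterssonFamily`: all weights even
and `≥ 2`, and `4πΓ(k−1) ∑_{wt f = k} conj(PH f m) PH f n = δ_{mn} + 2π i^k ∑_{c ≡ 0 (r)} c⁻¹ S(m,n;c) J_{k−1}(4π√(mn)/c)`
for even `k ≥ 2`, `m, n ≥ 1`). [cite: DeshouillersIwaniec1982, (4.4) p. 249; Drappeau2017, §4.1.2 (4.5)] -/
def PetInf (D : ℕ → SpecData) : Prop :=
  ∀ r : ℕ, 1 ≤ r → PeterssonFamily (D r).ιh (D r).wt (D r).PH r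

/-- **Hypothesis (P0): Petersson's formula at the cusp `0`** (Iwaniec's scaling `σ₀ = (0, −1/√r; √r, 0)`,
for which `σ₀⁻¹Γ₀(r)σ₀ = Γ₀(r)` and the Kloosterman sums `S₀₀` are the classical ones with
`c ≡ 0 (mod r)`) for the data `(ιh, wt, QH)` of `D r`, every `r ≥ 1`.
[cite: DeshouillersIwaniec1982, (4.4) p. 249; Drappeau2017, §4.1.2 (4.5)] -/
def PetZero (D : ℕ → SpecData) : Prop :=
  ∀ r : ℕ, 1 ≤ r → PeterssonFamily (D r).ιh (D r).wt (D r).QH r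

/-- `l2sq = l2` (the two spellings of `‖a‖²` in the tree). [folklore] -/
theorem l2sq_eq_l2 (N : ℝ) (a : ℕ → ℂ) : l2sq N a = l2 N a := rfl

/-- `N^{1+6ε₀} ≤ 2^{1+ε} N^{1+ε}` for `N ≥ 1/2` when `6ε₀ ≤ ε`, `0 ≤ ε₀`. [folklore] -/
theorem rpow_exponent_adjust {ε ε₀ N : ℝ} (hε : 0 < ε) (hε₀ : 0 ≤ ε₀) (h6 : 6 * ε₀ ≤ ε) (hN : 1 / 2 ≤ N) :
    N ^ (1 + 6 * ε₀) ≤ (2 : ℝ) ^ (1 + ε) * N ^ (1 + ε) := by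
  have hN0 : 0 < N := by linarith
  rcases le_or_gt 1 N with h1 | h1
  · calc N ^ (1 + 6 * ε₀) ≤ N ^ (1 + ε) := Real.rpow_le_rpow_of_exponent_le h1 (by linarith)
      _ = 1 * N ^ (1 + ε) := (one_mul _).symm
      _ ≤ (2 : ℝ) ^ (1 + ε) * N ^ (1 + ε) :=
          mul_le_mul_of_nonneg_right (Real.one_le_rpow (by norm_num) (by linarith)) (by positivity)
  · calc N ^ (1 + 6 * ε₀) ≤ 1 := Real.rpow_le_one hN0.le h1.le (by linarith)
      _ ≤ (2 * N) ^ (1 + ε) := Real.one_le_rpow (by linarith) (by linarith)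
      _ = (2 : ℝ) ^ (1 + ε) * N ^ (1 + ε) := Real.mul_rpow (by norm_num) hN0.le

/-- The common deduction: a Petersson family gives the large-sieve bound with the tree's exponent
bookkeeping (`ε₀ = min(ε, 1/2)/6`). [cite: DeshouillersIwaniec1982, Theorem 2 (1.28)] -/
theorem largeSieve_hol_tree {ε : ℝ} (hε : 0 < ε) :
    ∃ K : ℝ, 0 ≤ K ∧ ∀ (ι : Type) (wt : ι → ℕ) (P : ι → ℕ → ℂ) (r : ℕ), 1 ≤ r → PeterssonFamily ι wt P r →
      ∀ (T N : ℝ), 1 ≤ T → 1 / 2 ≤ N → ∀ (a : ℕ → ℂ) (F : Finset ι), (∀ f ∈ F, (wt f : ℝ) ≤ T) →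
        ∑ f ∈ F, Real.Gamma (wt f) * ‖∑ n ∈ dyadic N, a n * P f n‖ ^ 2 ≤
          K * (T ^ 2 + N ^ (1 + ε) / r) * l2sq N a := by
  obtain ⟨ε₀, hε₀⟩ : ∃ ε₀ : ℝ, ε₀ = min ε (1 / 2) / 6 := ⟨_, rfl⟩
  have hε₀0 : 0 < ε₀ := by rw [hε₀]; positivity
  have hε₀1 : ε₀ ≤ 1 / 12 := by
    rw [hε₀]; have := min_le_right ε (1 / 2); linarith
  have h6 : 6 * ε₀ ≤ ε := by rw [hε₀]; have := min_le_left ε (1 / 2); linarith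
  obtain ⟨A, hA0, hA⟩ := norm_quadB_le_short hε₀0
  obtain ⟨K, hK0, hK⟩ := largeSieve_hol_of_petersson hε₀0 hε₀1 hA0 hA
  refine ⟨K * (2 : ℝ) ^ (1 + ε), by positivity, ?_⟩
  intro ι wt P r hr hP T N hT hN a F hF
  have h1 := hK ι wt P r hr hP T N hT hN a F hF
  have hr0 : (0 : ℝ) < r := by exact_mod_cast hr
  have hL : 0 ≤ l2 N a := l2_nonneg N a
  have h2 : (1 : ℝ) ≤ (2 : ℝ) ^ (1 + ε) := Real.one_le_rpow (by norm_num) (by linarith)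
  have hNε := rpow_exponent_adjust hε hε₀0.le h6 hN
  rw [l2sq_eq_l2]
  calc ∑ f ∈ F, Real.Gamma (wt f) * ‖∑ n ∈ dyadic N, a n * P f n‖ ^ 2
      ≤ K * (T ^ 2 + N ^ (1 + 6 * ε₀) / r) * l2 N a := h1
    _ ≤ K * ((2 : ℝ) ^ (1 + ε) * T ^ 2 + (2 : ℝ) ^ (1 + ε) * N ^ (1 + ε) / r) * l2 N a := by
        have hT2 : T ^ 2 ≤ (2 : ℝ) ^ (1 + ε) * T ^ 2 := le_mul_of_one_le_left (by positivity) h2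
        have hN2 : N ^ (1 + 6 * ε₀) / r ≤ (2 : ℝ) ^ (1 + ε) * N ^ (1 + ε) / r :=
          div_le_div_of_nonneg_right hNε hr0.le
        gcongr
    _ = K * (2 : ℝ) ^ (1 + ε) * (T ^ 2 + N ^ (1 + ε) / r) * l2 N a := by ring

/-- **`LSHolInf` from Petersson's formula at `∞`** ([DeshouillersIwaniec1982, Theorem 2 (1.28)] for the
cusp `∞`, via §5.2). [cite: DeshouillersIwaniec1982, Theorem 2 (1.28)] -/
theorem lsHolInf_of_petersson {D : ℕ → SpecData} (h : PetInf D) : LSHolInf D := by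
  intro ε hε
  obtain ⟨K, hK0, hK⟩ := largeSieve_hol_tree hε
  exact ⟨K, hK0, fun r hr T N hT hN a F hF => hK (D r).ιh (D r).wt (D r).PH r hr (h r hr) T N hT hN a F hF⟩

/-- **`LSHolZero` from Petersson's formula at `0`** ([DeshouillersIwaniec1982, Theorem 2 (1.28)] for the
cusp `0`, via §5.2). [cite: DeshouillersIwaniec1982, Theorem 2 (1.28)] -/
theorem lsHolZero_of_petersson {D : ℕ → SpecData} (h : PetZero D) : LSHolZero D := by
  intro ε hε
  obtain ⟨K, hK0, hK⟩ := largeSieve_hol_tree hε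
  exact ⟨K, hK0, fun r hr T N hT hN a F hF => hK (D r).ιh (D r).wt (D r).QH r hr (h r hr) T N hT hN a F hF⟩

end BFI.L1

end Literature.NumberTheory.Sieve
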